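import Summits.CriticalPhenomena.PercolationContinuityZ3.Theorems.FK.RandomClusterEdgeDensityTiles
import HarnessLib

/-!
# LARGE DEVIATIONS OF THE NUMBER OF OPEN EDGES OF THE RANDOM-CLUSTER MODEL, VII: THE PLATEAU — EVERY EDGE DENSITY BETWEEN `d·h⁰(p,q)`
# AND `d·h¹(p,q)` IS REACHED AT SUB-VOLUME-ORDER COST UNDER EVERY INFINITE-VOLUME RANDOM-CLUSTER MEASURE (Lanford 1973 sub-additivity
# on the random-cluster side; Grimmett 2006 Lemma (4.13), (4.14)(b), Thm. (4.19)(c), (4.71); Ellis 2006 Thm. II.6.1 / V.6.1)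

Claimed R42 (8)(c) in the cell INBOX at 2026-08-29T13:50:16Z by fkp-10a gen 360 (NEW CLAIM #6 of the gen), addressed to coordinator fk-4 gen 299 (seated 12:03Z 2026-08-29; R182–R186 in force; ruling R187 requested); lineage row FO-10a-g360p (self-suggested), package g360-rcplateau, label RC-G.
Helper file of the `fk-continuity` build cell (bschramm lane; `--supports stmt-CriticalPhenomena-4575`; fkp-10a gen 360,
package g360-rcplateau, label RC-G); builds on p205010 (kernel theorem, internal audit signed; external expert review
pending). No definitions, no named facts, no sorries; standard axioms.
UNCONDITIONAL (`q ≥ 1`, `0 < p < 1`, a lattice edge `e₀` (so `d ≥ 1`); every `FKGibbs d p q P` — the two limits `φ^b_{p,q} = rcLimit d b p q`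
included; `Λ_N = {−N,…,N}^d`, `E_N = edgesIn (zdGraph d) Λ_N`, `|ω ∩ E_N|` = number of open edges of `Λ_N`, `h⁰ = freeEdgeDensity`,
`h¹ = wiredEdgeDensity`).
Scope: the volume-order LOWER bound `e^{−ε|Λ_N|}` for every window of the edge density at a point of `[d·h⁰(p,q), d·h¹(p,q)]`; no
surface-order statement, nothing at or about `p_c(q)` (the interval is a point unless `(p,q)` is a first-order point), nothing on FH / TP_FK;
nothing percolation-bearing.

The random-cluster analogue of the Ising file `MagnetizationPlateauLowerBound`: tile `Λ_N` by translates of `Λ_n` (`MagnetizationBlockTiling`),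
prescribe the wired density `d·h¹` on a fraction of the tiles and the free density `d·h⁰` on the rest (`exists_signs_abs_sum_sub_le`), and
multiply the two-sided conditional tile estimates of file VI (`fkGibbs_tile_high_ge` / `fkGibbs_tile_low_ge`, `prod_le_fkGibbs_real_biInter`),
each at least `e^{−ε|Λ_n|}`; the deterministic bookkeeping is `abs_div_sub_lt_of_tiles` (file VI):

* `eventually_exp_le_tile_high`, `eventually_exp_le_tile_low` — the two tile rates at scale `n` are `≥ e^{−ε|Λ_n|}` for all large `n`
  (files IV–V: boundary-condition cost `q^{|∂Λ_n|}`, Markov, and the exponential far tails of file II);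
* **`fkGibbs_exp_le_plateau_window`** — THE PLATEAU: for every `FKGibbs d p q P`, every `a ∈ [d·h⁰(p,q), d·h¹(p,q)]`, `δ, ε > 0`: eventually
  `e^{−ε|Λ_N|} ≤ P{||ω ∩ E_N|/|Λ_N| − a| < δ}`; `rcLimit_exp_le_plateau_window` — the instances `φ^b_{p,q}`;
  `fkGibbs_not_eventually_plateau_window_le_exp` — no such density is exponentially unlikely at volume order.

## References

* O. E. Lanford, *Entropy and equilibrium states in classical statistical mechanics*, LNP 20 (1973), §A4 (sub-additivity). [Lanford1973]
* G. Grimmett, *The Random-Cluster Model*, Springer (2006), Lemma (4.13), Lemma (4.14)(b), Thm. (4.19)(c), §4.5 (4.71), Thm. (4.63).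
  [Grimmett2006]
* R. S. Ellis, *Entropy, Large Deviations, and Statistical Mechanics*, Springer (2006), Thm. II.6.1, Thm. V.6.1 (d)–(e). [Ellis2006]
-/

noncomputable section

namespace Summit.CriticalPhenomena.PercolationContinuityZ3.Theorems.FK

namespace RandomClusterLargeDeviations

open Finset Filter Topology Set MeasureTheory
open Literature.Probability.LatticeModels Literature.Probability.Percolation
open IsingLargeDeviations

variable {d : ℕ} {p q : ℝ} {e₀ : Sym2 (Site d)} {P : Measure (BondConfig (Site d))}

/-! ### The two tile rates at scale `n` are at least `e^{−ε|Λ_n|}` -/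

/-- **High tiles**: for `δ, ε > 0`, eventually in `n`,
`e^{−ε|Λ_n|} ≤ φ⁰_{Λ_n}{(d·h¹ − δ)|Λ_n| ≤ |ω|} − φ¹_{Λ_n}{(d·h¹ + δ)|Λ_n| ≤ |ω|}`. [cite: Grimmett2006, §4.5 (4.71), Thm. (4.58); Ellis2006, Thm. II.6.1] -/
theorem eventually_exp_le_tile_high (hp : p ∈ Set.Ioo (0 : ℝ) 1) (hq : 1 ≤ q) (he₀ : e₀ ∈ (zdGraph d).edgeSet) {δ : ℝ} (hδ : 0 < δ)
    {ε : ℝ} (hε : 0 < ε) :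
    ∀ᶠ n : ℕ in atTop, Real.exp (-(ε * #(box d n))) ≤
      (rcMeasure (finsetGraph (zdGraph d) (box d n)) p q (boxBC d false n)).real
          {η : BondConfig ↥(box d n) | (d * wiredEdgeDensity d p q e₀ - δ) * #(box d n) ≤ (η.ncard : ℝ)} -
        (rcMeasure (finsetGraph (zdGraph d) (box d n)) p q (boxBC d true n)).real
          {η : BondConfig ↥(box d n) | (d * wiredEdgeDensity d p q e₀ + δ) * #(box d n) ≤ (η.ncard : ℝ)} := by
  have hpI : p ∈ Set.Icc (0 : ℝ) 1 := ⟨hp.1.le, hp.2.le⟩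
  have hq0 : 0 < q := one_pos.trans_le hq
  obtain ⟨i₀, -, -⟩ := exists_eq_map_add_of_mem_edgeSet he₀
  have hd : 0 < d := i₀.pos
  obtain ⟨κ, hκ, hA⟩ := exists_pos_eventually_le_wired_high hpI hq he₀ hδ
  obtain ⟨c, hc, hU⟩ := rc_upper_tail_exp_decay hp hq he₀ (m := d * wiredEdgeDensity d p q e₀ + δ) (by linarith)
  have h := eventually_forall_exp_le_of_boundary_sub_exp (d := d) (ι := Unit) hq hκ hc
    (f := fun n _ => (rcMeasure (finsetGraph (zdGraph d) (box d n)) p q (boxBC d false n)).real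
          {η : BondConfig ↥(box d n) | (d * wiredEdgeDensity d p q e₀ - δ) * #(box d n) ≤ (η.ncard : ℝ)} -
        (rcMeasure (finsetGraph (zdGraph d) (box d n)) p q (boxBC d true n)).real
          {η : BondConfig ↥(box d n) | (d * wiredEdgeDensity d p q e₀ + δ) * #(box d n) ≤ (η.ncard : ℝ)}) ?_ hd hε
  · exact h.mono fun n hn => hn ()
  filter_upwards [hA, hU true] with n hAn hUn _
  have hAb := (pow_inv_mul_rcMeasure_box_real_le hpI hq n true false
    {η : BondConfig ↥(box d n) | (d * wiredEdgeDensity d p q e₀ - δ) * #(box d n) ≤ (η.ncard : ℝ)})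
  exact sub_le_sub ((mul_le_mul_of_nonneg_left hAn (inv_nonneg.2 (pow_nonneg hq0.le _))).trans hAb) hUn

/-- **Low tiles**: for `δ, ε > 0`, eventually in `n`,
`e^{−ε|Λ_n|} ≤ φ¹_{Λ_n}{|ω| ≤ (d·h⁰ + δ)|Λ_n|} − φ⁰_{Λ_n}{|ω| ≤ (d·h⁰ − δ)|Λ_n|}`. [cite: Grimmett2006, §4.5 (4.71), Thm. (4.58); Ellis2006, Thm. II.6.1] -/
theorem eventually_exp_le_tile_low (hp : p ∈ Set.Ioo (0 : ℝ) 1) (hq : 1 ≤ q) (he₀ : e₀ ∈ (zdGraph d).edgeSet) {δ : ℝ} (hδ : 0 < δ)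
    {ε : ℝ} (hε : 0 < ε) :
    ∀ᶠ n : ℕ in atTop, Real.exp (-(ε * #(box d n))) ≤
      (rcMeasure (finsetGraph (zdGraph d) (box d n)) p q (boxBC d true n)).real
          {η : BondConfig ↥(box d n) | (η.ncard : ℝ) ≤ (d * freeEdgeDensity d p q e₀ + δ) * #(box d n)} -
        (rcMeasure (finsetGraph (zdGraph d) (box d n)) p q (boxBC d false n)).real
          {η : BondConfig ↥(box d n) | (η.ncard : ℝ) ≤ (d * freeEdgeDensity d p q e₀ - δ) * #(box d n)} := by
  have hpI : p ∈ Set.Icc (0 : ℝ) 1 := ⟨hp.1.le, hp.2.le⟩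
  have hq0 : 0 < q := one_pos.trans_le hq
  obtain ⟨i₀, -, -⟩ := exists_eq_map_add_of_mem_edgeSet he₀
  have hd : 0 < d := i₀.pos
  obtain ⟨κ, hκ, hA⟩ := exists_pos_eventually_le_free_low hpI hq he₀ hδ
  obtain ⟨c, hc, hL⟩ := rc_lower_tail_exp_decay hp hq he₀ (m := d * freeEdgeDensity d p q e₀ - δ) (by linarith)
  have h := eventually_forall_exp_le_of_boundary_sub_exp (d := d) (ι := Unit) hq hκ hc
    (f := fun n _ => (rcMeasure (finsetGraph (zdGraph d) (box d n)) p q (boxBC d true n)).real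
          {η : BondConfig ↥(box d n) | (η.ncard : ℝ) ≤ (d * freeEdgeDensity d p q e₀ + δ) * #(box d n)} -
        (rcMeasure (finsetGraph (zdGraph d) (box d n)) p q (boxBC d false n)).real
          {η : BondConfig ↥(box d n) | (η.ncard : ℝ) ≤ (d * freeEdgeDensity d p q e₀ - δ) * #(box d n)}) ?_ hd hε
  · exact h.mono fun n hn => hn ()
  filter_upwards [hA, hL false] with n hAn hLn _
  have hAb := (pow_inv_mul_rcMeasure_box_real_le hpI hq n false true
    {η : BondConfig ↥(box d n) | (η.ncard : ℝ) ≤ (d * freeEdgeDensity d p q e₀ + δ) * #(box d n)})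
  exact sub_le_sub ((mul_le_mul_of_nonneg_left hAn (inv_nonneg.2 (pow_nonneg hq0.le _))).trans hAb) hLn

/-! ### The plateau -/

/-- **THE PHASE-COEXISTENCE PLATEAU OF THE EDGE DENSITY UNDER EVERY INFINITE-VOLUME RANDOM-CLUSTER MEASURE** (`q ≥ 1`, `0 < p < 1`,
`d ≥ 1`): for every `FKGibbs d p q P`, every `a ∈ [d·h⁰(p,q), d·h¹(p,q)]` and `δ, ε > 0`, eventually in `N`,
`e^{−ε|Λ_N|} ≤ P{||ω ∩ E_N|/|Λ_N| − a| < δ}` — the large-deviation LOWER bound at volume order vanishes on the whole interval between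
the free and the wired edge densities (a point unless `(p,q)` is a first-order point). Proof: Lanford tiling with wired-density and
free-density tiles and the conditional sandwich of the DLR–FKG structure (`prod_le_fkGibbs_real_biInter`).
[cite: Lanford1973, §A4; Grimmett2006, Lemma (4.13), (4.14)(b), Thm. (4.19)(c), §4.5 (4.71); Ellis2006, Thm. II.6.1, Thm. V.6.1 (d)–(e)] -/
theorem fkGibbs_exp_le_plateau_window (hP : FKGibbs d p q P) (hp : p ∈ Set.Ioo (0 : ℝ) 1) (hq : 1 ≤ q)
    (he₀ : e₀ ∈ (zdGraph d).edgeSet) {a : ℝ}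
    (ha : a ∈ Set.Icc (d * freeEdgeDensity d p q e₀) (d * wiredEdgeDensity d p q e₀)) {δ : ℝ} (hδ : 0 < δ) {ε : ℝ}
    (hε : 0 < ε) :
    ∀ᶠ N : ℕ in atTop, Real.exp (-(ε * #(box d N))) ≤
      P.real {ω | |((ω ∩ ↑(edgesIn (zdGraph d) (box d N))).ncard : ℝ) / #(box d N) - a| < δ} := by
  classical
  haveI := hP.isProbabilityMeasure
  have hpI : p ∈ Set.Icc (0 : ℝ) 1 := ⟨hp.1.le, hp.2.le⟩
  have hq0 : 0 < q := one_pos.trans_le hq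
  obtain ⟨i₀, -, -⟩ := exists_eq_map_add_of_mem_edgeSet he₀
  have hd : 0 < d := i₀.pos
  -- Step 1: the scale `n`: both tile rates `≥ e^{−ε|Λ_n|}` (tolerance `δ/8`) and `|E_n| > (d − δ/16)|Λ_n|`
  have hEn : ∀ᶠ n : ℕ in atTop, ((d : ℝ) - δ / 16) * #(box d n) < #(edgesIn (zdGraph d) (box d n)) := by
    filter_upwards [(tendsto_card_edgesIn_box_div_card_box (d := d)).eventually
      (lt_mem_nhds (show (d : ℝ) - δ / 16 < d by linarith))] with n hn
    have hV : (0 : ℝ) < #(box d n) := by exact_mod_cast (box_nonempty d n).card_pos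
    rwa [lt_div_iff₀ hV] at hn
  obtain ⟨n, ⟨hnH, hnL⟩, hnE⟩ := (((eventually_exp_le_tile_high hp hq he₀ (δ := δ / 8) (by positivity) hε).and
    (eventually_exp_le_tile_low hp hq he₀ (δ := δ / 8) (by positivity) hε)).and hEn).exists
  -- the two phases `κ₀ = d·h⁰ ≤ κ₁ = d·h¹`, their midpoint `κ` and half-distance `m`
  set κ₀ : ℝ := d * freeEdgeDensity d p q e₀ with hκ₀
  set κ₁ : ℝ := d * wiredEdgeDensity d p q e₀ with hκ₁
  have hκ : κ₀ ≤ κ₁ := mul_le_mul_of_nonneg_left (freeEdgeDensity_le_wiredEdgeDensity hd hpI hq e₀) (Nat.cast_nonneg d)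
  obtain ⟨m, hm⟩ : ∃ m : ℝ, m = (κ₁ - κ₀) / 2 := ⟨_, rfl⟩
  obtain ⟨κ, hκm⟩ : ∃ κ : ℝ, κ = (κ₀ + κ₁) / 2 := ⟨_, rfl⟩
  have hm0 : 0 ≤ m := by rw [hm]; linarith only [hκ]
  have hk1 : κ + m = κ₁ := by rw [hm, hκm]; ring
  have hk0 : κ + -m = κ₀ := by rw [hm, hκm]; ring
  have habs : |a - κ| ≤ m := by
    rw [hm, hκm, abs_le]
    constructor <;> linarith only [ha.1, ha.2]
  have hm1 : 0 < 2 * n + 1 := by omega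
  have hVn : (#(box d n) : ℝ) = ((2 * n + 1 : ℕ) : ℝ) ^ d := by rw [card_box]; push_cast; ring
  -- Step 2: the tiles of `Λ_N`, for `N` large
  choose A hA using fun N => exists_tiles_subset (d := d) hm1 (box d N)
  have hfrac := tendsto_card_tiles_mul_div (d := d) (fun N => #(A N)) (fun N => (hA N).2)
  have hK := tendsto_card_tiles_atTop hd hm1 (fun N => #(A N)) (fun N => (hA N).2)
  have hev1 : ∀ᶠ N : ℕ in atTop, 1 - δ / (4 * (|a| + d + 1)) < ((#(A N) : ℝ) * ((2 * n + 1 : ℕ) : ℝ) ^ d) / #(box d N) :=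
    hfrac.eventually (lt_mem_nhds (by
      have : 0 < δ / (4 * (|a| + d + 1)) := by positivity
      linarith only [this]))
  have hev2 : ∀ᶠ N : ℕ in atTop, 16 * (m + 1) / δ * #(box d n) < (#(A N) : ℝ) := hK.eventually (eventually_gt_atTop _)
  have hev3 : ∀ᶠ N : ℕ in atTop, (#(edgesIn (zdGraph d) (box d N)) : ℝ) < ((d : ℝ) + δ / 16) * #(box d N) := by
    filter_upwards [(tendsto_card_edgesIn_box_div_card_box (d := d)).eventually
      (gt_mem_nhds (show (d : ℝ) < d + δ / 16 by linarith))] with N hN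
    have hV : (0 : ℝ) < #(box d N) := by exact_mod_cast (box_nonempty d N).card_pos
    rwa [div_lt_iff₀ hV] at hN
  filter_upwards [hev1, hev2, hev3] with N h1 h2 h3
  obtain ⟨hAsub, hAle, -⟩ := hA N
  have hV : (0 : ℝ) < #(box d N) := by exact_mod_cast (box_nonempty d N).card_pos
  have hAle' : (#(A N) : ℝ) * #(box d n) ≤ #(box d N) := by rw [hVn]; exact_mod_cast hAle
  rw [← hVn, lt_div_iff₀ hV] at h1
  -- Step 3: the phases of the tiles (`κ + t_v ∈ {κ₁, κ₀}`)
  obtain ⟨t, ht, hsum⟩ := exists_signs_abs_sum_sub_le (A N) hm0 habs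
  -- Step 4: the tiles as translates of `Λ_n`, their events and their rates
  obtain ⟨C, hC⟩ : ∃ C : Site d → Finset (Site d),
      ∀ v, C v = (box d n).map (Site.shift (fun i => (n : ℤ) + ((2 * n + 1 : ℕ) : ℤ) * v i)).toEmbedding :=
    ⟨_, fun v => rfl⟩
  have hC' : ∀ v, C v = (halfOpenBox d (2 * n + 1)).map (Site.shift (((2 * n + 1 : ℕ) : ℤ) • v)).toEmbedding :=
    fun v => by rw [hC v, box_eq_map_shift_smul_add]
  have hCsub : ∀ v ∈ A N, C v ⊆ box d N := fun v hv => by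
    rw [hC']
    exact hAsub v hv
  have hCdisj : ∀ v ∈ A N, ∀ w ∈ A N, v ≠ w → Disjoint (C v) (C w) := fun v _ w _ hvw => by
    rw [hC', hC']
    exact disjoint_map_shift_halfOpenBox hm1 hvw
  have hCE : ∀ v, (#(edgesIn (zdGraph d) (C v)) : ℝ) = #(edgesIn (zdGraph d) (box d n)) := fun v => by
    rw [hC v, card_edgesIn_map_shift]
  obtain ⟨W, hW⟩ : ∃ W : Site d → Set (BondConfig (Site d)), ∀ v, W v = if t v = m
      then {ω | ((ω ∩ ↑(edgesIn (zdGraph d) (C v))).ncard : ℝ) ∈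
        Set.Ico ((κ₁ - δ / 8) * #(box d n)) ((κ₁ + δ / 8) * #(box d n))}
      else {ω | ((ω ∩ ↑(edgesIn (zdGraph d) (C v))).ncard : ℝ) ∈
        Set.Ioc ((κ₀ - δ / 8) * #(box d n)) ((κ₀ + δ / 8) * #(box d n))} :=
    ⟨_, fun v => rfl⟩
  obtain ⟨rH, hrH⟩ : ∃ r : ℝ, r = regionFreeReal d p q (box d n)
        {ω : BondConfig (Site d) | ((ω ∩ ↑(edgesIn (zdGraph d) (box d n))).ncard : ℝ) ∈ Set.Ici ((κ₁ - δ / 8) * #(box d n))} -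
      regionWiredReal d p q (box d n)
        {ω : BondConfig (Site d) | ((ω ∩ ↑(edgesIn (zdGraph d) (box d n))).ncard : ℝ) ∈ Set.Ici ((κ₁ + δ / 8) * #(box d n))} :=
    ⟨_, rfl⟩
  obtain ⟨rL, hrL⟩ : ∃ r : ℝ, r = regionWiredReal d p q (box d n)
        {ω : BondConfig (Site d) | ((ω ∩ ↑(edgesIn (zdGraph d) (box d n))).ncard : ℝ) ∈ Set.Iic ((κ₀ + δ / 8) * #(box d n))} -
      regionFreeReal d p q (box d n)
        {ω : BondConfig (Site d) | ((ω ∩ ↑(edgesIn (zdGraph d) (box d n))).ncard : ℝ) ∈ Set.Iic ((κ₀ - δ / 8) * #(box d n))} :=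
    ⟨_, rfl⟩
  -- the region laws of the threshold events are the box-measure tails of Step 1: both rates are `≥ e^{−ε|Λ_n|}`
  have hrH' : Real.exp (-(ε * #(box d n))) ≤ rH := by
    rw [← regionFreeReal_edgeCount_ge hpI hq0 n, ← regionWiredReal_edgeCount_ge hpI hq0 n] at hnH
    rw [hrH]
    exact hnH
  have hrL' : Real.exp (-(ε * #(box d n))) ≤ rL := by
    rw [← regionWiredReal_edgeCount_le hpI hq0 n, ← regionFreeReal_edgeCount_le hpI hq0 n] at hnL
    rw [hrL]
    exact hnL
  have hr0 : ∀ v ∈ A N, 0 ≤ (if t v = m then rH else rL) := fun v _ => by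
    split_ifs
    exacts [(Real.exp_pos _).le.trans hrH', (Real.exp_pos _).le.trans hrL']
  have hWdet : ∀ v ∈ A N, DeterminedBy (W v) ↑(edgesIn (zdGraph d) (C v)) := fun v _ => by
    rw [hW v]
    split_ifs
    exacts [determinedBy_edgeCount_mem _ _, determinedBy_edgeCount_mem _ _]
  -- the conditional sandwich for each tile, transported from `Λ_n` by translation covariance
  have hstep : ∀ v ∈ A N, ∀ (H : Set (BondConfig (Site d))) (T : Finset (Sym2 (Site d))),
      Disjoint (↑T : Set (Sym2 (Site d))) ↑(edgesIn (zdGraph d) (C v)) → DeterminedBy H ↑T →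
        (if t v = m then rH else rL) * P.real H ≤ P.real (W v ∩ H) := by
    intro v _ H T hT hH
    rw [hW v]
    split_ifs with htv
    · have h := fkGibbs_tile_high_ge hP (C v) T hT hH ((κ₁ - δ / 8) * #(box d n)) ((κ₁ + δ / 8) * #(box d n))
      rw [hC v, regionFreeReal_edgeCount_map_shift hpI hq0, regionWiredReal_edgeCount_map_shift hpI hq0, ← hrH] at h
      rw [hC v]
      exact h
    · have h := fkGibbs_tile_low_ge hP hpI hq0 (C v) T hT hH ((κ₀ - δ / 8) * #(box d n)) ((κ₀ + δ / 8) * #(box d n))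
      rw [hC v, regionWiredReal_edgeCount_map_shift hpI hq0, regionFreeReal_edgeCount_map_shift hpI hq0, ← hrL] at h
      rw [hC v]
      exact h
  -- Step 5: probability of the intersection of the tile events
  have hprod := prod_le_fkGibbs_real_biInter hP (A N) C hCdisj W hWdet (fun v => if t v = m then rH else rL) hr0 hstep
  have hprob : Real.exp (-(ε * #(box d N))) ≤ P.real (⋂ v ∈ A N, W v) := by
    refine le_trans ?_ ((Finset.prod_le_prod (fun _ _ => (Real.exp_pos (-(ε * #(box d n)))).le) fun v hv => ?_).trans
      hprod)
    · rw [Finset.prod_const, ← Real.exp_nat_mul, Real.exp_le_exp]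
      have := mul_le_mul_of_nonneg_left hAle' hε.le
      linarith only [this]
    · show Real.exp (-(ε * #(box d n))) ≤ (if t v = m then rH else rL)
      split_ifs
      exacts [hrH', hrL']
  -- Step 6: the intersection of the tile events lies in the window (deterministic bookkeeping)
  have hsubW : (⋂ v ∈ A N, W v) ⊆ {ω | |((ω ∩ ↑(edgesIn (zdGraph d) (box d N))).ncard : ℝ) / #(box d N) - a| < δ} := by
    intro ω hω
    refine abs_div_sub_lt_of_tiles hCsub hCdisj hCE hδ hm0 hsum hnE h1 h2 h3 hAle' fun v hv => ?_
    -- per tile: `|M_v − (κ + t_v)|Λ_n|| ≤ (δ/8)|Λ_n|`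
    have hvW := (Set.mem_iInter₂.1 hω) v hv
    rw [hW v] at hvW
    split_ifs at hvW with htv
    · rw [Set.mem_setOf_eq, Set.mem_Ico] at hvW
      rw [htv, hk1, abs_le]
      constructor <;> linarith only [hvW.1, hvW.2]
    · rw [Set.mem_setOf_eq, Set.mem_Ioc] at hvW
      rw [(ht v).resolve_left htv, hk0, abs_le]
      constructor <;> linarith only [hvW.1, hvW.2]
  exact hprob.trans (measureReal_mono hsubW)

/-- **THE LIMIT MEASURES `φ^b_{p,q}`**: the plateau lower bound `e^{−ε|Λ_N|} ≤ φ^b_{p,q}{||ω ∩ E_N|/|Λ_N| − a| < δ}` eventually, for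
every `a ∈ [d·h⁰(p,q), d·h¹(p,q)]`, `b = 0, 1`. [cite: Grimmett2006, Thm. (4.19)(c), §4.5 (4.71); Lanford1973, §A4] -/
theorem rcLimit_exp_le_plateau_window (hp : p ∈ Set.Ioo (0 : ℝ) 1) (hq : 1 ≤ q) (he₀ : e₀ ∈ (zdGraph d).edgeSet) (b : Bool)
    {a : ℝ} (ha : a ∈ Set.Icc (d * freeEdgeDensity d p q e₀) (d * wiredEdgeDensity d p q e₀)) {δ : ℝ} (hδ : 0 < δ) {ε : ℝ}
    (hε : 0 < ε) :
    ∀ᶠ N : ℕ in atTop, Real.exp (-(ε * #(box d N))) ≤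
      (rcLimit d b p q).real {ω | |((ω ∩ ↑(edgesIn (zdGraph d) (box d N))).ncard : ℝ) / #(box d N) - a| < δ} :=
  fkGibbs_exp_le_plateau_window
    (fkGibbs_rcLimit_of_exists ⟨hp.1.le, hp.2.le⟩ hq (exists_isBoxLimit b ⟨hp.1.le, hp.2.le⟩ hq)) hp hq he₀ ha hδ hε

/-- **NOT EXPONENTIALLY UNLIKELY**: for every `FKGibbs d p q P`, `a ∈ [d·h⁰(p,q), d·h¹(p,q)]`, `δ > 0` and `c > 0` it is NOT the case
that eventually `P{||ω ∩ E_N|/|Λ_N| − a| < δ} ≤ e^{−c|Λ_N|}` — on the coexistence interval the volume-order rate function of the edge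
density vanishes. [cite: Ellis2006, Thm. II.6.1 and Note 13 to Ch. IV; Grimmett2006, §4.5 (4.71)] -/
theorem fkGibbs_not_eventually_plateau_window_le_exp (hP : FKGibbs d p q P) (hp : p ∈ Set.Ioo (0 : ℝ) 1) (hq : 1 ≤ q)
    (he₀ : e₀ ∈ (zdGraph d).edgeSet) {a : ℝ}
    (ha : a ∈ Set.Icc (d * freeEdgeDensity d p q e₀) (d * wiredEdgeDensity d p q e₀)) {δ : ℝ} (hδ : 0 < δ) {c : ℝ}
    (hc : 0 < c) :
    ¬ ∀ᶠ N : ℕ in atTop, P.real {ω | |((ω ∩ ↑(edgesIn (zdGraph d) (box d N))).ncard : ℝ) / #(box d N) - a| < δ} ≤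
      Real.exp (-(c * #(box d N))) := by
  intro h
  obtain ⟨N, hN1, hN2⟩ := ((fkGibbs_exp_le_plateau_window hP hp hq he₀ ha hδ (half_pos hc)).and h).exists
  have hV : (1 : ℝ) ≤ #(box d N) := by exact_mod_cast (box_nonempty d N).card_pos
  have := hN1.trans hN2
  rw [Real.exp_le_exp] at this
  nlinarith

end RandomClusterLargeDeviations

end Summit.CriticalPhenomena.PercolationContinuityZ3.Theorems.FK
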